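import Literature.MathematicalPhysics.QuantumManyBody.BoseGasClusterStates

/-!
# Hard-core Bose gases with a locally integrable tail: blow-up at the critical density and
# boundary-condition independence at every density

Topic `Literature/MathematicalPhysics/QuantumManyBody`, over the carriers of
`BoseEinsteinCondensation.lean` / `BoseGasThermodynamicLimit.lean` (Dirichlet trial states,
`groundStateEnergy v N L = E₀^D(N,L)`, `energyPerParticleDirichlet/Periodic`, `sideLength`),
`BoseGasThermodynamicLimitRuelle.lean` (`SupportedState`, `rawEnergy`, translation, the envelope
`limsupEnergyPerParticle v ρ = e⁺(ρ)`, `criticalDensity v = ρ_c(v)`, `infEnergy`),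
`BoseGasClusterStates.lean` (the cluster state of one bump per cube with interaction,
`exists_infEnergy_clusterRegion_le`, `pairBall`), `BoseGasBoundaryConditionIndependence.lean`
(the corrected fact
`LSSY2005_e0_periodic_eq_dirichlet_offCritical` and the blow-up case at `ρ_c`),
`BoseGasHardCoreContact.lean` / `BoseGasHardCoreCriticalDensity.lean` (few tight pairs at finite
energy, the Markov step, the box fit, and the same programme for BOUNDED tails).

Context. The vendored facts `LSSY2005_e0_dirichlet_exists` / `LSSY2005_e0_periodic_eq_dirichlet`
(LSSY 2005, Ch. 2, (2.2): "These [boundary conditions] should not matter for the thermodynamic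
limit") quantify over every density `ρ > 0`, including the critical density `ρ_c(v) < ∞` of a
potential with a hard core, where the corrected off-critical facts leave exactly the question
whether the energy per particle blows up on approach to `ρ_c`
(`LSSY2005_e0_periodic_eq_dirichlet_iff_atCritical_of_iSup_lt_top`).
`BoseGasHardCoreCriticalDensity.lean` settled it for hard cores with a tail BOUNDED on `[a, ∞)`.
This file removes the boundedness: it treats **hard-core potentials with a locally integrable
tail** — `v = +∞` on `r < a` (LSSY Ch. 2, after (2.1): "the hard core potential `v(r) = ∞` if
`r < a`"), finite range `R₀`, and `∫_{|x| > b} v(|x|) dx < ∞` for every `b > a`, i.e.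
`∫_b^{R₀} v(r) r² dr < ∞` for all `b > a`: any blow-up of the tail at contact `r ↓ a` and any
integrable singularities beyond the core are allowed (the bounded-tail class is recovered in
`iSup_limsupEnergyPerParticle_eq_top_of_hardCore_of_tail_le`):

* `iSup_limsupEnergyPerParticle_eq_top_of_hardCore'` — **blow-up at the critical density**: for
  `ρ ≥ ρ_c(v)`, `sup_{0<ρ'<ρ} e⁺(ρ') = +∞`;
* `hardCore_e0_dirichlet_exists'`, `hardCore_e0_periodic_eq_dirichlet'` — hence the conclusions
  of BOTH vendored facts hold for such potentials at EVERY density `ρ > 0`;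
and, by the same trial states with no core at all (`a = 0`),
* `criticalDensity_eq_top_of_locallyIntegrable` — **no hard core, no critical density**: if
  `∫_{|x|>b} v(|x|)dx < ∞` for every `b > 0` (any non-integrable repulsive singularity AT the
  origin allowed, e.g. `r^{-12} 𝟙_{r<R₀}`; this extends the soft class `∫_{ℝ³} v < ∞` of
  `criticalDensity_eq_top_of_lintegral_ne_top`), then `ρ_c(v) = ∞`;
* `e0_dirichlet_exists_of_core_locallyIntegrable`, `e0_periodic_eq_dirichlet_of_core_locallyIntegrable`
  — the conclusions of both vendored facts at every `ρ > 0` for every repulsive finite-range `v`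
  that is `+∞` on a possibly empty `[0, a)` and locally integrable (weight `r²`) on `(a, ∞)`;
* `LSSY2005_e0_periodic_eq_dirichlet_iff_residual` — what remains of the vendored fact: only
  potentials outside that class (a NON-integrable singularity that is not a pointwise hard core:
  `+∞` on a fat Cantor set of distances, `(r - r₀)⁻¹` at some `r₀ > a`, …), and only at `ρ = ρ_c(v)`.

Proof. The free-volume compression argument of `BoseGasHardCoreCriticalDensity.lean`
(`limsupEnergyPerParticle_lt_top_of_compression'`, a copy of
`limsupEnergyPerParticle_lt_top_of_compression` up to the energy bound for the compressed
configuration): suppose `e⁺ ≤ G < ∞` on `(0, ρ_c)`; a near-minimiser at density `ρ' ↑ ρ_c` does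
not vanish at a configuration with few tight particles (`BoseGasHardCoreContact`); discarding them
and scaling by `(a+δ/2)/(a+δ)` leaves `M ≥ (1-ε)N - 1` particles pairwise `≥ a + δ/2` apart,
carrying cubes of side `s = δ/8` inside a box of the larger density `ρ'(1 + δ/(4a)) > ρ_c` —
contradiction, once `E₀^D(M, ·) ≤ M · const` for such configurations WITHOUT a pointwise bound
on the tail (`groundStateEnergy_le_of_separated_cubes`). That bound comes from the cluster state
of `BoseGasClusterStates.lean` (one translated bump per cube, symmetrised, interaction kept:
`exists_infEnergy_clusterRegion_le`, energy `≤ M E₁ + C ∑_{pairs} ∫_{B(c_m - c_{m'}, 2s)} v`):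
for centres `≥ b + 2s` apart the pair ball lies in `{|w| > b}`, so each pair costs at most the
tail integral `∫_{|w|>b} v(|w|) dw` (`pairBall_le_tail`) and nothing when the centres are
`≥ R₀ + 2s` apart (`pairBall_eq_zero_of_le_dist`), while by volume at most
`(2(R₀+2s)/(b+2s) + 1)³` centres are that close (`card_filter_dist_lt_le_pow'`,
`sum_pairBall_le`); with `b = a + δ/4` the tail integral is finite by hypothesis. With no core
(`a = 0`) the same bound on the `q³` cells of the unit cube gives `E₀^D(q³, 1) < ∞` for all `q`
(`groundStateEnergy_cube_lt_top_of_locallyIntegrable`), whence `ρ_c = ∞` by Ruelle's basic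
inequality (`limsup_energyPerParticle_le`).

References: E. H. Lieb, R. Seiringer, J. P. Solovej, J. Yngvason, *The Mathematics of the Bose Gas
and its Condensation* (2005) [LSSY2005], Ch. 2; D. Ruelle, *Statistical Mechanics: Rigorous
Results* (1969) [Ruelle1969], §3.3.12 (close packing is due to hard cores) and §3.5.11
(symmetrised products of states in separated regions). The compression argument for these carriers
we have not found in print and tag folklore.

Deliberately NOT here: potentials with a non-integrable singular shell at some distance `r₀ > 0`
that is not inside a pointwise hard core `[0, a)` — with or without a core (this needs the
vanishing of finite-energy states on singular shells and a tightness notion relative to them);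
the value of `ρ_c`.
-/

noncomputable section

open MeasureTheory Filter Topology Set Function
open scoped ENNReal NNReal

namespace Literature.MathematicalPhysics.QuantumManyBody.BoseGas

/-! ### Pair terms of the cluster state for separated cubes -/

section PairBall

variable {v : ℝ → ℝ≥0∞} {s b R₀ : ℝ}

/-- **Neighbour count by volume** for a finite family of points pairwise `≥ t` apart: at most
`(2r/t + 1)³` of them are within `r` of a given one. [folklore] -/
theorem card_filter_dist_lt_le_pow' {t : ℝ} (ht : 0 < t) {r : ℝ} (hr : 0 < r) {y : ℕ → Space}
    {T : Finset ℕ} (hsep : ∀ m ∈ T, ∀ m' ∈ T, m ≠ m' → t ≤ dist (y m) (y m')) (k : ℕ) :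
    (((T.filter fun m => m ≠ k ∧ dist (y k) (y m) < r).card : ℕ) : ℝ) ≤ (2 * r / t + 1) ^ 3 := by
  set J := T.filter fun m => m ≠ k ∧ dist (y k) (y m) < r with hJ
  have hdisj : (J : Set ℕ).PairwiseDisjoint fun m => Metric.ball (y m) (t / 2) := by
    intro m hm m' hm' hmm'
    have hmT : m ∈ T := (Finset.mem_filter.1 hm).1
    have hm'T : m' ∈ T := (Finset.mem_filter.1 hm').1
    exact Metric.ball_disjoint_ball (by rw [add_halves]; exact hsep m hmT m' hm'T hmm')
  have hsub : (⋃ m ∈ J, Metric.ball (y m) (t / 2)) ⊆ Metric.ball (y k) (r + t / 2) := by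
    intro x hx
    simp only [mem_iUnion] at hx
    obtain ⟨m, hm, hx⟩ := hx
    have hm' := (Finset.mem_filter.1 hm).2.2
    rw [Metric.mem_ball] at hx ⊢
    calc dist x (y k) ≤ dist x (y m) + dist (y m) (y k) := dist_triangle _ _ _
      _ < t / 2 + r := add_lt_add hx (by rwa [dist_comm])
      _ = r + t / 2 := by ring
  have hvol := measure_mono (μ := volume) hsub
  rw [measure_biUnion_finset hdisj (fun m _ => measurableSet_ball)] at hvol
  simp only [Measure.addHaar_ball volume _ (by positivity : (0:ℝ) ≤ t / 2), Finset.sum_const,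
    nsmul_eq_mul, finrank_euclideanSpace_fin] at hvol
  rw [Measure.addHaar_ball volume _ (by positivity : (0:ℝ) ≤ r + t / 2),
    finrank_euclideanSpace_fin] at hvol
  have hV0 : volume (Metric.ball (0 : Space) 1) ≠ 0 := (Metric.measure_ball_pos volume _ one_pos).ne'
  have hVt : volume (Metric.ball (0 : Space) 1) ≠ ⊤ := measure_ball_lt_top.ne
  rw [← mul_assoc] at hvol
  have h1 : (J.card : ℝ≥0∞) * ENNReal.ofReal ((t / 2) ^ 3) ≤ ENNReal.ofReal ((r + t / 2) ^ 3) :=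
    (ENNReal.mul_le_mul_iff_left hV0 hVt).1 hvol
  have h2 : ((J.card : ℝ≥0∞) * ENNReal.ofReal ((t / 2) ^ 3)).toReal ≤
      (ENNReal.ofReal ((r + t / 2) ^ 3)).toReal :=
    ENNReal.toReal_mono ENNReal.ofReal_ne_top h1
  rw [ENNReal.toReal_mul, ENNReal.toReal_natCast, ENNReal.toReal_ofReal (by positivity),
    ENNReal.toReal_ofReal (by positivity)] at h2
  have h3 : (r + t / 2) ^ 3 = (2 * r / t + 1) ^ 3 * (t / 2) ^ 3 := by
    rw [← mul_pow]; congr 1; field_simp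
  rw [h3] at h2
  exact le_of_mul_le_mul_right h2 (by positivity)

/-- **Far cubes do not interact**: if the centres are `≥ R₀ + 2s` apart (`R₀` the range of
`v`), the pair term `∫_{B(c_m - c_{m'}, 2s)} v(|w|) dw` vanishes. [folklore] -/
theorem pairBall_eq_zero_of_le_dist (hrange : ∀ r, R₀ < r → v r = 0) {c : ℕ → Space} {m m' : ℕ}
    (hfar : R₀ + 2 * s ≤ dist (c m) (c m')) : pairBall v c s m' m = 0 := by
  unfold pairBall
  refine (setLIntegral_congr_fun measurableSet_ball (fun w hw => ?_)).trans lintegral_zero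
  refine hrange _ ?_
  rw [Metric.mem_ball, dist_eq_norm] at hw
  have h1 : ‖c m - c m'‖ ≤ ‖c m - c m' - w‖ + ‖w‖ := norm_le_norm_sub_add _ _
  rw [← dist_eq_norm (c m), norm_sub_rev] at h1
  linarith

/-- **Near cubes interact through the tail only**: if the centres are `≥ b + 2s` apart, the pair
term is at most the tail integral `∫_{|w| > b} v(|w|) dw`. [folklore] -/
theorem pairBall_le_tail {c : ℕ → Space} {m m' : ℕ} (hsep : b + 2 * s ≤ dist (c m) (c m')) :
    pairBall v c s m' m ≤ ∫⁻ w in {w : Space | b < ‖w‖}, v ‖w‖ := by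
  unfold pairBall
  refine lintegral_mono_set fun w hw => ?_
  rw [Metric.mem_ball, dist_eq_norm] at hw
  have h1 : ‖c m - c m'‖ ≤ ‖c m - c m' - w‖ + ‖w‖ := norm_le_norm_sub_add _ _
  rw [← dist_eq_norm (c m), norm_sub_rev] at h1
  show b < ‖w‖
  linarith

/-- **The pair terms of one cube against all others**, for centres pairwise `≥ b + 2s` apart: at
most `(2(R₀+2s)/(b+2s) + 1)³` cubes are within interaction distance, each contributing at most
the tail integral. [folklore] -/
theorem sum_pairBall_le (hR : 0 ≤ R₀) (hrange : ∀ r, R₀ < r → v r = 0) (hs : 0 < s) (hb : 0 < b)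
    {c : ℕ → Space} {M : ℕ}
    (hsep : ∀ m < M, ∀ m' < M, m ≠ m' → b + 2 * s ≤ dist (c m) (c m')) {m : ℕ} (hm : m < M) :
    ∑ m' ∈ Finset.range m, pairBall v c s m' m ≤
      ENNReal.ofReal ((2 * (R₀ + 2 * s) / (b + 2 * s) + 1) ^ 3) *
        ∫⁻ w in {w : Space | b < ‖w‖}, v ‖w‖ := by
  set I : ℝ≥0∞ := ∫⁻ w in {w : Space | b < ‖w‖}, v ‖w‖ with hI
  calc ∑ m' ∈ Finset.range m, pairBall v c s m' m
      ≤ ∑ m' ∈ Finset.range m, (if dist (c m) (c m') < R₀ + 2 * s then I else 0) := by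
        refine Finset.sum_le_sum fun m' hm' => ?_
        have hm'm : m' < m := Finset.mem_range.1 hm'
        by_cases hnear : dist (c m) (c m') < R₀ + 2 * s
        · rw [if_pos hnear]
          exact pairBall_le_tail (hsep m hm m' (by omega) (by omega))
        · rw [if_neg hnear]
          exact (pairBall_eq_zero_of_le_dist hrange (not_lt.1 hnear)).le
    _ = I * ((Finset.range m).filter fun m' => dist (c m) (c m') < R₀ + 2 * s).card := by
        rw [Finset.sum_ite, Finset.sum_const_zero, add_zero, Finset.sum_const, nsmul_eq_mul,
          mul_comm]
    _ ≤ I * ENNReal.ofReal ((2 * (R₀ + 2 * s) / (b + 2 * s) + 1) ^ 3) := by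
        gcongr
        have hsub : ((Finset.range m).filter fun m' => dist (c m) (c m') < R₀ + 2 * s) ⊆
            (Finset.range M).filter fun m' => m' ≠ m ∧ dist (c m) (c m') < R₀ + 2 * s := by
          intro m' hm'
          simp only [Finset.mem_filter, Finset.mem_range] at hm' ⊢
          exact ⟨by omega, by omega, hm'.2⟩
        have hsepc : ∀ k ∈ Finset.range M, ∀ k' ∈ Finset.range M, k ≠ k' →
            b + 2 * s ≤ dist (c k) (c k') := fun k hk k' hk' hne =>
          hsep k (Finset.mem_range.1 hk) k' (Finset.mem_range.1 hk') hne
        have hc := card_filter_dist_lt_le_pow' (by positivity : 0 < b + 2 * s)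
          (by positivity : 0 < R₀ + 2 * s) hsepc m
        calc ((((Finset.range m).filter fun m' => dist (c m) (c m') < R₀ + 2 * s).card : ℕ) :
              ℝ≥0∞)
            ≤ ((((Finset.range M).filter fun m' => m' ≠ m ∧ dist (c m) (c m') < R₀ + 2 * s).card :
                ℕ) : ℝ≥0∞) := by exact_mod_cast Finset.card_le_card hsub
          _ = ENNReal.ofReal ((((Finset.range M).filter fun m' =>
                m' ≠ m ∧ dist (c m) (c m') < R₀ + 2 * s).card : ℕ) : ℝ) := by
              rw [ENNReal.ofReal_natCast]
          _ ≤ _ := ENNReal.ofReal_le_ofReal hc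
    _ = _ := mul_comm _ _

/-- The cluster region of cubes inside the box lies in the box. [folklore] -/
theorem clusterRegion_subset_box {c : ℕ → Space} {M : ℕ} {L' : ℝ}
    (hbox : ∀ m < M, cubeAt (c m) s ⊆ box L') : clusterRegion c s M ⊆ box L' := by
  intro x hx
  simp only [clusterRegion, Set.mem_iUnion, Finset.mem_range, exists_prop] at hx
  obtain ⟨m, hm, hxm⟩ := hx
  exact hbox m hm hxm

/-- **Upper bound for the Dirichlet energy of `M` bosons placed in separated cubes.** Given the
cluster-state bound of `BoseGasClusterStates.lean` with constants `E₁, C` (for the potential `v`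
and the cube side `s`), if `Λ_{L'}` contains `M` cubes of side `s` with centres pairwise
`≥ b + 2s` apart (`b > 0`), then
`E₀^D(M, L') ≤ M (E₁ + C (2(R₀+2s)/(b+2s) + 1)³ ∫_{|w|>b} v(|w|) dw)`: one particle per cube,
each interacting with boundedly many others and only through the tail of `v` beyond `b`.
[cite: Ruelle1969, §3.5.11] -/
theorem groundStateEnergy_le_of_separated_cubes (hR : 0 ≤ R₀) (hrange : ∀ r, R₀ < r → v r = 0)
    (hs : 0 < s) (hb : 0 < b) {E₁ C : ℝ≥0∞}
    (hclus : ∀ (n : ℕ) (c : ℕ → Space), (∀ m m', m < m' → m' < n → 2 * s ≤ dist (c m) (c m')) →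
      infEnergy v n (clusterRegion c s n) ≤
        n * E₁ + C * ∑ m ∈ Finset.range n, ∑ m' ∈ Finset.range m, pairBall v c s m' m)
    {M : ℕ} {L' : ℝ} (y : ℕ → Space) (hbox : ∀ m < M, cubeAt (y m) s ⊆ box L')
    (hsep : ∀ m < M, ∀ m' < M, m ≠ m' → b + 2 * s ≤ dist (y m) (y m')) :
    groundStateEnergy v M L' ≤ M * (E₁ +
      C * ENNReal.ofReal ((2 * (R₀ + 2 * s) / (b + 2 * s) + 1) ^ 3) *
        ∫⁻ w in {w : Space | b < ‖w‖}, v ‖w‖) := by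
  set K₀ : ℝ≥0∞ := ENNReal.ofReal ((2 * (R₀ + 2 * s) / (b + 2 * s) + 1) ^ 3) with hK₀
  set I : ℝ≥0∞ := ∫⁻ w in {w : Space | b < ‖w‖}, v ‖w‖ with hI
  have hsep2 : ∀ m m', m < m' → m' < M → 2 * s ≤ dist (y m) (y m') := fun m m' hmm' hm' =>
    le_trans (by linarith) (hsep m (by omega) m' hm' (by omega))
  calc groundStateEnergy v M L' = infEnergy v M (box L') := groundStateEnergy_eq_infEnergy v M L'
    _ ≤ infEnergy v M (clusterRegion y s M) := infEnergy_anti (clusterRegion_subset_box hbox)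
    _ ≤ M * E₁ + C * ∑ m ∈ Finset.range M, ∑ m' ∈ Finset.range m, pairBall v y s m' m :=
        hclus M y hsep2
    _ ≤ M * E₁ + C * ∑ m ∈ Finset.range M, K₀ * I := by
        gcongr with m hm
        exact sum_pairBall_le hR hrange hs hb hsep (Finset.mem_range.1 hm)
    _ = M * (E₁ + C * K₀ * I) := by
        rw [Finset.sum_const, Finset.card_range, nsmul_eq_mul]
        ring

end PairBall

/-! ### The compression lemma for a locally integrable tail -/

section Compression

variable {a R₀ : ℝ} {v : ℝ → ℝ≥0∞}

/-- **The compression lemma (free-volume argument), locally integrable tail.** Let `v` have a hard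
core of diameter `a` (`v = +∞` on `r < a`), range `R₀`, and `∫_{|w| > a + δ/4} v(|w|) dw < ∞`. If
along the cube sequence of density `ρ'` the Dirichlet energies satisfy `E₀^D(N, L_N(ρ')) ≤ G N` for
all large `N` (`G < ∞`), then for `0 < δ ≤ a/20` with `2304 a (G+1) δ ≤ 1` the upper energy per
particle is finite at the strictly larger density `ρ'(1 + δ/(4a))`. As in
`limsupEnergyPerParticle_lt_top_of_compression` a near-minimiser does not vanish at a
configuration with at most `576 δ² (G+1) N + 1` tight particles; discarding them and scaling by
`(a + δ/2)/(a + δ)` leaves `M ≥ (1-ε)N - 1` particles carrying disjoint cubes of side `δ/8` whose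
centres are pairwise `≥ a + δ/2` apart, inside a box of the larger density; the cluster state of
`BoseGasClusterStates.lean` on these cubes (`groundStateEnergy_le_of_separated_cubes`) has energy at
most `M (E₁ + C (2(R₀+δ/4)/(a+δ/2) + 1)³ ∫_{|w|>a+δ/4} v)`, each particle interacting with
boundedly many others, each pair through the integrable tail beyond `a + δ/4` only. [folklore] -/
theorem limsupEnergyPerParticle_lt_top_of_compression' (ha : 0 < a) (hR : 0 ≤ R₀)
    (hv : Measurable v) (hcore : ∀ r, r < a → v r = ⊤) (hrange : ∀ r, R₀ < r → v r = 0)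
    {δ : ℝ} (hδ : 0 < δ) (hδa : 20 * δ ≤ a)
    (hI : (∫⁻ w in {w : Space | a + δ / 4 < ‖w‖}, v ‖w‖) ≠ ⊤)
    {ρ' : ℝ} (hρ' : 0 < ρ') {G : ℝ≥0∞} (hG : G ≠ ⊤)
    (hδG : 2304 * a * (G.toReal + 1) * δ ≤ 1)
    (hbound : ∀ᶠ N : ℕ in atTop, groundStateEnergy v N (sideLength ρ' N) ≤ G * N) :
    limsupEnergyPerParticle v (ρ' * (1 + δ / (4 * a))) < ⊤ := by
  obtain ⟨N₀, hN₀⟩ := eventually_atTop.1 hbound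
  -- constants
  set g : ℝ := G.toReal with hg
  have hg0 : 0 ≤ g := ENNReal.toReal_nonneg
  have hG' : G = ENNReal.ofReal g := (ENNReal.ofReal_toReal hG).symm
  set ε : ℝ := 576 * δ ^ 2 * (g + 1) with hε
  have hε0 : 0 ≤ ε := by positivity
  have hεδ : ε ≤ δ / (4 * a) := by
    rw [hε, le_div_iff₀ (by positivity)]
    nlinarith [mul_pos hδ (by positivity : (0:ℝ) < a * (g + 1))]
  have hδa' : δ / (4 * a) ≤ 1 / 80 := by
    rw [div_le_div_iff₀ (by positivity) (by norm_num)]; linarith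
  have hε1 : ε ≤ 1 / 80 := hεδ.trans hδa'
  set μ : ℝ := (a + δ / 2) / (a + δ) with hμ
  have hμ0 : 0 < μ := by positivity
  have hμa : μ * (a + δ) = a + δ / 2 := by rw [hμ]; field_simp
  set s : ℝ := δ / 8 with hs
  have hs0 : 0 < s := by positivity
  set b : ℝ := a + δ / 4 with hb
  have hb0 : 0 < b := by positivity
  -- the cluster-state constants and the energy bound per particle
  obtain ⟨E₁, C, hE₁, hC, hclus⟩ := exists_infEnergy_clusterRegion_le hv hs0
  set I : ℝ≥0∞ := ∫⁻ w in {w : Space | b < ‖w‖}, v ‖w‖ with hIdef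
  set K₀ : ℝ≥0∞ := ENNReal.ofReal ((2 * (R₀ + 2 * s) / (b + 2 * s) + 1) ^ 3) with hK₀
  set e₁ : ℝ≥0∞ := E₁ + C * K₀ * I with he₁
  have he₁top : e₁ < ⊤ := by
    refine ENNReal.add_lt_top.2 ⟨hE₁, ?_⟩
    exact ENNReal.mul_lt_top (ENNReal.mul_lt_top hC ENNReal.ofReal_lt_top) hI.lt_top
  set ρ'' : ℝ := ρ' * (1 + δ / (4 * a)) with hρ''
  have hρ''0 : 0 < ρ'' := by positivity
  -- the strict density inequality `ρ'' μ³ < (1 - ε) ρ'`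
  have hκ : ρ'' * μ ^ 3 < (1 - ε) * ρ' := by
    have hpoly : (4 * a + δ) * (a + δ / 2) ^ 3 < (4 * a - δ) * (a + δ) ^ 3 := by
      have hexp : (4 * a - δ) * (a + δ) ^ 3 - (4 * a + δ) * (a + δ / 2) ^ 3 =
          δ * (4 * a ^ 3 + 9 / 2 * a ^ 2 * δ - 1 / 4 * a * δ ^ 2 - 9 / 8 * δ ^ 3) := by ring
      have hpos : 0 < 4 * a ^ 3 + 9 / 2 * a ^ 2 * δ - 1 / 4 * a * δ ^ 2 - 9 / 8 * δ ^ 3 := by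
        have hδa1 : δ ≤ a := by linarith
        nlinarith [mul_pos ha hδ, pow_pos ha 3, mul_pos (pow_pos ha 2) hδ,
          mul_le_mul_of_nonneg_left hδa1 (by positivity : (0:ℝ) ≤ a * δ),
          mul_le_mul_of_nonneg_left hδa1 (by positivity : (0:ℝ) ≤ δ ^ 2)]
      nlinarith [mul_pos hδ hpos]
    have h1 : ρ'' * μ ^ 3 = ρ' * ((4 * a + δ) * (a + δ / 2) ^ 3 / (4 * a * (a + δ) ^ 3)) := by
      rw [hρ'', hμ]; field_simp
    have h2 : (1 - δ / (4 * a)) * ρ' = ρ' * ((4 * a - δ) * (a + δ) ^ 3 / (4 * a * (a + δ) ^ 3)) := by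
      field_simp
    have h3 : ρ'' * μ ^ 3 < (1 - δ / (4 * a)) * ρ' := by
      rw [h1, h2]
      refine mul_lt_mul_of_pos_left ?_ hρ'
      exact div_lt_div_of_pos_right hpoly (by positivity)
    have h4 : (1 - δ / (4 * a)) * ρ' ≤ (1 - ε) * ρ' :=
      mul_le_mul_of_nonneg_right (by linarith) hρ'.le
    exact h3.trans_le h4
  -- box fit
  obtain ⟨M₀, hfit⟩ := exists_forall_box_fit hρ' hρ''0 hμ0 hδ.le hε0 (by linarith)
    (by positivity : (0:ℝ) ≤ N₀ + 2) hκ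
  -- the main claim: for large `M`, `E₀^D(M, L_M(ρ''))/M ≤ e₁`
  have hclaim : ∀ M : ℕ, max M₀ 1 ≤ M → energyPerParticleDirichlet v ρ'' M ≤ e₁ := by
    intro M hM
    have hMM₀ : M₀ ≤ M := (le_max_left _ _).trans hM
    have hM1 : 1 ≤ M := (le_max_right _ _).trans hM
    have hM0 : (M : ℝ≥0∞) ≠ 0 := Nat.cast_ne_zero.2 (by omega)
    -- the particle number `N` of the state we compress
    set N : ℕ := ⌈((M : ℝ) + 1) / (1 - ε)⌉₊ + N₀ + 1 with hN
    have hNN₀ : N₀ ≤ N := by omega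
    have hN1 : 0 < N := by omega
    have hNge : ((M : ℝ) + 1) / (1 - ε) ≤ N := by
      refine (Nat.le_ceil _).trans ?_
      rw [hN]; push_cast; linarith
    have hNle : (N : ℝ) ≤ ((M : ℝ) + 1) / (1 - ε) + (N₀ + 2) := by
      have := Nat.ceil_lt_add_one (div_nonneg (by positivity) (by linarith) :
        (0:ℝ) ≤ ((M : ℝ) + 1) / (1 - ε))
      rw [hN]; push_cast; linarith
    set L : ℝ := sideLength ρ' N with hL
    -- a trial state with energy `< (G+1) N`
    have hgs : groundStateEnergy v N L < (G + 1) * N :=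
      (hN₀ N hNN₀).trans_lt ((ENNReal.mul_lt_mul_iff_left (Nat.cast_ne_zero.2 hN1.ne')
        (ENNReal.natCast_ne_top N)).2 (ENNReal.lt_add_right hG one_ne_zero))
    rw [groundStateEnergy] at hgs
    obtain ⟨Ψ, hΨ⟩ := iInf_lt_iff.1 hgs
    have hEtop : rawEnergy v Ψ.ψ ≠ ⊤ := (lt_of_lt_of_le hΨ le_top).ne
    have hKE : ∫⁻ X, kineticDensity Ψ.ψ X ≤ (G + 1) * N :=
      (lintegral_mono fun X => le_self_add).trans hΨ.le
    -- the Markov step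
    obtain ⟨X₀, hX₀ne, hX₀count⟩ :=
      exists_ne_zero_tightPairCount_le ha hδ hδa hcore Ψ.contDiff hEtop Ψ.norm_eq
    have hX₀box : X₀ ∈ boxN N L := by
      by_contra h; exact hX₀ne (Ψ.eq_zero X₀ h)
    have hX₀sep : ∀ i j : Fin N, i ≠ j → a < dist (X₀ i) (X₀ j) := by
      intro i j hij
      by_contra h
      exact hX₀ne (eq_zero_of_dist_le ha hcore Ψ.contDiff.continuous hEtop X₀ i j hij (not_lt.1 h))
    -- the tight set is small
    set T := tightSet a δ X₀ with hT
    have hTcard : ((T.card : ℕ) : ℝ) ≤ ε * N + 1 := by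
      have h1 : ((T.card : ℕ) : ℝ≥0∞) ≤ ENNReal.ofReal (576 * δ ^ 2) * ((G + 1) * N) + 1 :=
        (card_tightSet_le a δ X₀).trans (hX₀count.trans
          (add_le_add (mul_le_mul' le_rfl hKE) le_rfl))
      have h2 : ENNReal.ofReal (576 * δ ^ 2) * ((G + 1) * N) + 1 = ENNReal.ofReal (ε * N + 1) := by
        rw [hG', ← ENNReal.ofReal_one, ← ENNReal.ofReal_add hg0 zero_le_one,
          ← ENNReal.ofReal_natCast N, ← ENNReal.ofReal_mul (by positivity),
          ← ENNReal.ofReal_mul (by positivity), ← ENNReal.ofReal_add (by positivity) zero_le_one]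
        congr 1
        rw [hε]; ring
      rw [h2] at h1
      have h3 := ENNReal.toReal_mono ENNReal.ofReal_ne_top h1
      rwa [ENNReal.toReal_ofReal (by positivity), ENNReal.toReal_natCast] at h3
    -- the good set has at least `M` particles
    set Gd : Finset (Fin N) := Tᶜ with hGd
    have hGdcard : M ≤ Gd.card := by
      have hTle : T.card ≤ N := by simpa using T.card_le_univ
      have h1 : (Gd.card : ℝ) = N - T.card := by
        rw [hGd, Finset.card_compl, Fintype.card_fin, Nat.cast_sub hTle]
      have h2 : ((M : ℝ) + 1) ≤ (1 - ε) * N := by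
        rwa [div_le_iff₀' (by linarith)] at hNge
      have h3 : (M : ℝ) ≤ Gd.card := by rw [h1]; nlinarith
      exact_mod_cast h3
    obtain ⟨S, hSG, hScard⟩ := Finset.exists_subset_card_eq hGdcard
    -- index the chosen good particles by `Fin M`
    have hcardS : Fintype.card S = M := by simp [hScard]
    let eS : Fin M ≃ S := (Fintype.equivFinOfCardEq hcardS).symm
    let idx : Fin M → Fin N := fun m => (eS m : Fin N)
    have hidx_mem : ∀ m, idx m ∈ S := fun m => (eS m).2
    have hidx_inj : Function.Injective idx := fun m m' h => eS.injective (Subtype.ext h)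
    have hgood : ∀ m, idx m ∉ T := fun m => Finset.mem_compl.1 (hSG (hidx_mem m))
    -- centres and cubes, indexed by `ℕ`
    let c : Space := WithLp.toLp 2 fun _ => δ
    let y : ℕ → Space := fun n => if h : n < M then μ • X₀ (idx ⟨n, h⟩) + c else 0
    have hy : ∀ n (h : n < M), y n = μ • X₀ (idx ⟨n, h⟩) + c := fun n h => by
      simp only [y, dif_pos h]
    have hydist : ∀ m (hm : m < M) m' (hm' : m' < M), m ≠ m' → a + δ / 2 ≤ dist (y m) (y m') := by
      intro m hm m' hm' hmm'
      have hne : idx ⟨m', hm'⟩ ≠ idx ⟨m, hm⟩ := fun h =>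
        hmm' (by have := hidx_inj h; simpa using this.symm)
      have h1 : a + δ ≤ dist (X₀ (idx ⟨m, hm⟩)) (X₀ (idx ⟨m', hm'⟩)) :=
        le_dist_of_not_mem_tightSet (hgood _) hne (hX₀sep _ _ hne.symm)
      have h2 : dist (y m) (y m') = μ * dist (X₀ (idx ⟨m, hm⟩)) (X₀ (idx ⟨m', hm'⟩)) := by
        rw [hy m hm, hy m' hm']
        simp only [dist_add_right, dist_smul₀, Real.norm_eq_abs, abs_of_pos hμ0]
      rw [h2, ← hμa]
      exact mul_le_mul_of_nonneg_left h1 hμ0.le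
    have hsepc : ∀ m < M, ∀ m' < M, m ≠ m' → b + 2 * s ≤ dist (y m) (y m') := by
      intro m hm m' hm' hmm'
      have h1 := hydist m hm m' hm' hmm'
      have hs8 : s = δ / 8 := rfl
      have hb4 : b = a + δ / 4 := rfl
      linarith
    have hUbox : ∀ m < M, cubeAt (y m) s ⊆ box (μ * L + 2 * δ) := by
      intro m hm
      refine cubeAt_subset_box fun k => ?_
      have hk : X₀ (idx ⟨m, hm⟩) k ∈ Set.Ioo 0 L := hX₀box (idx ⟨m, hm⟩) k
      have hyk : y m k = μ * X₀ (idx ⟨m, hm⟩) k + δ := by rw [hy m hm]; simp [c]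
      rw [hyk]
      have hs8 : s = δ / 8 := rfl
      constructor
      · have : 0 ≤ μ * X₀ (idx ⟨m, hm⟩) k := mul_nonneg hμ0.le hk.1.le
        linarith
      · have : μ * X₀ (idx ⟨m, hm⟩) k ≤ μ * L := mul_le_mul_of_nonneg_left hk.2.le hμ0.le
        linarith
    -- energy of `M` particles in the box of side `μ L + 2δ`
    have hEM : groundStateEnergy v M (μ * L + 2 * δ) ≤ M * e₁ :=
      groundStateEnergy_le_of_separated_cubes hR hrange hs0 hb0 hclus y hUbox hsepc
    -- the box fits, hence the bound at density `ρ''`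
    have hfitM : μ * L + 2 * δ ≤ sideLength ρ'' M := hfit M hMM₀ N hNle
    calc energyPerParticleDirichlet v ρ'' M
        = groundStateEnergy v M (sideLength ρ'' M) / M := rfl
      _ ≤ groundStateEnergy v M (μ * L + 2 * δ) / M :=
          ENNReal.div_le_div_right (groundStateEnergy_anti v M hfitM) _
      _ ≤ M * e₁ / M := ENNReal.div_le_div_right hEM _
      _ = e₁ := by rw [mul_comm]; exact ENNReal.mul_div_cancel_right hM0 (ENNReal.natCast_ne_top M)
  -- conclusion
  refine lt_of_le_of_lt ?_ he₁top
  exact Filter.limsup_le_of_le (h := (eventually_atTop.2 ⟨max M₀ 1, hclaim⟩))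

end Compression

/-! ### Blow-up at the critical density and both LSSY conclusions, locally integrable tail -/

section CriticalDensity

variable {a R₀ : ℝ} {v : ℝ → ℝ≥0∞}

/-- **A bounded tail is locally integrable**: if `v ≤ V < ∞` on `[a, ∞)` and `v` vanishes beyond
`R₀`, then `∫_{|x| > b} v(|x|) dx ≤ V |B_{R₀}| < ∞` for every `b > a`; so the class of this file
contains that of `BoseGasHardCoreCriticalDensity.lean`. [folklore] -/
theorem setLIntegral_norm_ne_top_of_tail_le {V : ℝ≥0∞} (hV : V ≠ ⊤)
    (htail : ∀ r, a ≤ r → v r ≤ V) (hrange : ∀ r, R₀ < r → v r = 0) {b : ℝ} (hb : a < b) :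
    (∫⁻ x in {x : Space | b < ‖x‖}, v ‖x‖) ≠ ⊤ := by
  have hle : ∀ x ∈ {x : Space | b < ‖x‖},
      v ‖x‖ ≤ (Metric.closedBall (0 : Space) R₀).indicator (fun _ => V) x := by
    intro x hx
    by_cases hxR : ‖x‖ ≤ R₀
    · rw [Set.indicator_of_mem (by simpa using hxR)]
      exact htail _ (hb.trans hx).le
    · rw [hrange _ (not_le.1 hxR)]; exact zero_le
  refine (lt_of_le_of_lt ?_ (ENNReal.mul_lt_top hV.lt_top
    (measure_closedBall_lt_top (μ := (volume : Measure Space)) (x := (0 : Space)) (r := R₀)))).ne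
  calc ∫⁻ x in {x : Space | b < ‖x‖}, v ‖x‖
      ≤ ∫⁻ x in {x : Space | b < ‖x‖}, (Metric.closedBall (0 : Space) R₀).indicator (fun _ => V) x :=
        setLIntegral_mono' (measurableSet_lt measurable_const measurable_norm) hle
    _ ≤ ∫⁻ x, (Metric.closedBall (0 : Space) R₀).indicator (fun _ => V) x :=
        setLIntegral_le_lintegral _ _
    _ = V * volume (Metric.closedBall (0 : Space) R₀) :=
        lintegral_indicator_const measurableSet_closedBall V

/-- **Blow-up of the energy per particle at the critical density, hard core with a locally
integrable tail.** For a potential with a hard core of diameter `a` (`v = +∞` on `r < a`), finite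
range, and a tail that is integrable away from the core (`∫_{|x| > b} v(|x|) dx < ∞` for every
`b > a`; any divergence at contact `r ↓ a` is allowed), and any `ρ ≥ ρ_c(v)`, the left envelope
`sup_{0<ρ'<ρ} e⁺(ρ')` of the Dirichlet energy per particle is `+∞`. Otherwise the compression
lemma would produce a finite upper energy per particle strictly above `ρ_c(v)`. [folklore] -/
theorem iSup_limsupEnergyPerParticle_eq_top_of_hardCore' (ha : 0 < a) (hR : 0 ≤ R₀)
    (hv : Measurable v) (hcore : ∀ r, r < a → v r = ⊤)
    (htail : ∀ b, a < b → (∫⁻ x in {x : Space | b < ‖x‖}, v ‖x‖) ≠ ⊤)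
    (hrange : ∀ r, R₀ < r → v r = 0) {ρ : ℝ}
    (hρc : criticalDensity v ≤ ENNReal.ofReal ρ) :
    (⨆ (ρ' : ℝ) (_ : 0 < ρ' ∧ ρ' < ρ), limsupEnergyPerParticle v ρ') = ⊤ := by
  by_contra hne
  set Gm := ⨆ (ρ' : ℝ) (_ : 0 < ρ' ∧ ρ' < ρ), limsupEnergyPerParticle v ρ' with hGm
  have hvR : IsRepulsiveFiniteRange v := ⟨hv, R₀, hrange⟩
  have hρpos : 0 < ρ := by
    have h := (criticalDensity_pos hvR).trans_le hρc
    simpa using h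
  set G : ℝ≥0∞ := Gm + 1 with hGdef
  have hG : G ≠ ⊤ := by simpa [hGdef] using hne
  set g : ℝ := G.toReal with hg
  have hg0 : 0 ≤ g := ENNReal.toReal_nonneg
  set δ : ℝ := min (a / 20) (1 / (2304 * a * (g + 1))) with hδ
  have hδ0 : 0 < δ := lt_min (by positivity) (by positivity)
  have hδa : 20 * δ ≤ a := by
    have := min_le_left (a / 20) (1 / (2304 * a * (g + 1))); linarith
  have hδG : 2304 * a * (g + 1) * δ ≤ 1 := by
    have h := min_le_right (a / 20) (1 / (2304 * a * (g + 1)))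
    rw [le_div_iff₀ (by positivity)] at h
    linarith
  set ρ' : ℝ := ρ / (1 + δ / (8 * a)) with hρ'
  have hρ'0 : 0 < ρ' := by positivity
  have hρ'lt : ρ' < ρ := div_lt_self hρpos (by
    have : 0 < δ / (8 * a) := by positivity
    linarith)
  -- `e⁺(ρ') ≤ Gm < G`, hence `E₀^D(N, L_N(ρ')) ≤ G N` eventually
  have hlim : limsupEnergyPerParticle v ρ' < G :=
    (le_iSup₂ (f := fun ρ' (_ : 0 < ρ' ∧ ρ' < ρ) => limsupEnergyPerParticle v ρ') ρ'
      ⟨hρ'0, hρ'lt⟩).trans_lt (ENNReal.lt_add_right hne one_ne_zero)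
  have hbound : ∀ᶠ N : ℕ in atTop, groundStateEnergy v N (sideLength ρ' N) ≤ G * N := by
    have hev : ∀ᶠ N : ℕ in atTop, energyPerParticleDirichlet v ρ' N < G :=
      Filter.eventually_lt_of_limsup_lt hlim
    filter_upwards [hev, eventually_gt_atTop 0] with N hN hN0
    rw [energyPerParticleDirichlet, ENNReal.div_lt_iff (Or.inl (Nat.cast_ne_zero.2 hN0.ne'))
      (Or.inl (ENNReal.natCast_ne_top N))] at hN
    exact hN.le
  have hI : (∫⁻ w in {w : Space | a + δ / 4 < ‖w‖}, v ‖w‖) ≠ ⊤ := htail _ (by linarith)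
  have hfin := limsupEnergyPerParticle_lt_top_of_compression' ha hR hv hcore hrange hδ0 hδa hI
    hρ'0 hG hδG hbound
  -- but `ρ'(1 + δ/(4a)) > ρ ≥ ρ_c(v)`
  have hgt : ρ < ρ' * (1 + δ / (4 * a)) := by
    rw [hρ', div_mul_eq_mul_div, lt_div_iff₀ (by positivity)]
    have : δ / (8 * a) < δ / (4 * a) := by
      rw [div_lt_div_iff₀ (by positivity) (by positivity)]; nlinarith
    nlinarith
  have hle : ENNReal.ofReal (ρ' * (1 + δ / (4 * a))) ≤ criticalDensity v :=
    le_iSup₂ (f := fun ρ (_ : 0 < ρ ∧ limsupEnergyPerParticle v ρ < ⊤) => ENNReal.ofReal ρ) _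
      ⟨by positivity, hfin⟩
  have h := hle.trans hρc
  rw [ENNReal.ofReal_le_ofReal_iff hρpos.le] at h
  linarith

/-- **At and above the critical density the Dirichlet energies per particle tend to `+∞`**
(hard core, locally integrable tail). [folklore] -/
theorem tendsto_energyPerParticleDirichlet_top_of_hardCore' (ha : 0 < a) (hR : 0 ≤ R₀)
    (hv : Measurable v) (hcore : ∀ r, r < a → v r = ⊤)
    (htail : ∀ b, a < b → (∫⁻ x in {x : Space | b < ‖x‖}, v ‖x‖) ≠ ⊤)
    (hrange : ∀ r, R₀ < r → v r = 0) {ρ : ℝ} (hρc : criticalDensity v ≤ ENNReal.ofReal ρ) :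
    Tendsto (energyPerParticleDirichlet v ρ) atTop (𝓝 ⊤) :=
  tendsto_energyPerParticleDirichlet_top_of_iSup_limsup_eq_top ⟨hv, R₀, hrange⟩
    (iSup_limsupEnergyPerParticle_eq_top_of_hardCore' ha hR hv hcore htail hrange hρc)

/-- … and so do the periodic ones. [folklore] -/
theorem tendsto_energyPerParticlePeriodic_top_of_hardCore' (ha : 0 < a) (hR : 0 ≤ R₀)
    (hv : Measurable v) (hcore : ∀ r, r < a → v r = ⊤)
    (htail : ∀ b, a < b → (∫⁻ x in {x : Space | b < ‖x‖}, v ‖x‖) ≠ ⊤)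
    (hrange : ∀ r, R₀ < r → v r = 0) {ρ : ℝ} (hρc : criticalDensity v ≤ ENNReal.ofReal ρ) :
    Tendsto (energyPerParticlePeriodic v ρ) atTop (𝓝 ⊤) :=
  tendsto_energyPerParticlePeriodic_top_of_iSup_limsup_eq_top ⟨hv, R₀, hrange⟩
    (iSup_limsupEnergyPerParticle_eq_top_of_hardCore' ha hR hv hcore htail hrange hρc)

/-- **Existence of the thermodynamic limit of the energy per particle at every density, hard
core with a locally integrable tail** (the conclusion of `LSSY2005_e0_dirichlet_exists` for this
class, with no exceptional density): below `ρ_c` the limit is `e⁺(ρ) < ∞` (Ruelle), at and above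
`ρ_c` it is `+∞`. [cite: LSSY2005, Ch. 2 eq. (2.2) and the paragraph following it] -/
theorem hardCore_e0_dirichlet_exists' (ha : 0 < a) (hR : 0 ≤ R₀) (hv : Measurable v)
    (hcore : ∀ r, r < a → v r = ⊤)
    (htail : ∀ b, a < b → (∫⁻ x in {x : Space | b < ‖x‖}, v ‖x‖) ≠ ⊤)
    (hrange : ∀ r, R₀ < r → v r = 0) {ρ : ℝ} (hρ : 0 < ρ) :
    ∃ e : ℝ≥0∞, Tendsto (energyPerParticleDirichlet v ρ) atTop (𝓝 e) := by
  by_cases hlt : ENNReal.ofReal ρ < criticalDensity v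
  · exact ⟨_, tendsto_energyPerParticleDirichlet_of_lt_criticalDensity ⟨hv, R₀, hrange⟩ hρ hlt⟩
  · exact ⟨⊤, tendsto_energyPerParticleDirichlet_top_of_hardCore' ha hR hv hcore htail hrange
      (not_lt.1 hlt)⟩

/-- **Boundary-condition independence at every density, hard core with a locally integrable
tail** (the conclusion of `LSSY2005_e0_periodic_eq_dirichlet` for potentials `v = +∞` on `r < a`
of finite range with `∫_{|x|>b} v(|x|)dx < ∞` for all `b > a` — no bound at contact required —
with no exceptional density): if the Dirichlet energies per particle converge to `e` then so do the
periodic ones. [cite: LSSY2005, Ch. 2, paragraph after (2.2); Thm. 2.2 ("for all boundary conditions")] -/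
theorem hardCore_e0_periodic_eq_dirichlet' (ha : 0 < a) (hR : 0 ≤ R₀) (hv : Measurable v)
    (hcore : ∀ r, r < a → v r = ⊤)
    (htail : ∀ b, a < b → (∫⁻ x in {x : Space | b < ‖x‖}, v ‖x‖) ≠ ⊤)
    (hrange : ∀ r, R₀ < r → v r = 0) {ρ : ℝ} (hρ : 0 < ρ)
    {e : ℝ≥0∞} (he : Tendsto (energyPerParticleDirichlet v ρ) atTop (𝓝 e)) :
    Tendsto (energyPerParticlePeriodic v ρ) atTop (𝓝 e) := by
  by_cases hne : ENNReal.ofReal ρ = criticalDensity v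
  · exact tendsto_energyPerParticlePeriodic_of_iSup_limsup_eq_top ⟨hv, R₀, hrange⟩
      (iSup_limsupEnergyPerParticle_eq_top_of_hardCore' ha hR hv hcore htail hrange hne.ge) he
  · exact LSSY2005_e0_periodic_eq_dirichlet_offCritical_holds v ⟨hv, R₀, hrange⟩ ρ hρ hne e he

/-- The bounded-tail class of `BoseGasHardCoreCriticalDensity.lean` is contained in the present
one: its blow-up theorem is recovered. [folklore] -/
theorem iSup_limsupEnergyPerParticle_eq_top_of_hardCore_of_tail_le (ha : 0 < a) (hR : 0 ≤ R₀)
    (hv : Measurable v) (hcore : ∀ r, r < a → v r = ⊤) {V : ℝ≥0∞} (hV : V ≠ ⊤)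
    (htail : ∀ r, a ≤ r → v r ≤ V) (hrange : ∀ r, R₀ < r → v r = 0) {ρ : ℝ}
    (hρc : criticalDensity v ≤ ENNReal.ofReal ρ) :
    (⨆ (ρ' : ℝ) (_ : 0 < ρ' ∧ ρ' < ρ), limsupEnergyPerParticle v ρ') = ⊤ :=
  iSup_limsupEnergyPerParticle_eq_top_of_hardCore' ha hR hv hcore
    (fun _ hb => setLIntegral_norm_ne_top_of_tail_le hV htail hrange hb) hrange hρc

end CriticalDensity

/-! ### No hard core: potentials locally integrable away from the origin have `ρ_c = ∞` -/

section SoftSingular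

variable {v : ℝ → ℝ≥0∞} {R₀ : ℝ}

/-- The base-`q` digits of `m`: the cell of `m` in the `q × q × q` grid. [folklore] -/
def gridDigit (q m : ℕ) : Fin 3 → ℕ := ![m % q, m / q % q, m / q / q]

/-- For `m < q³` all digits are `< q`. [folklore] -/
theorem gridDigit_lt {q m : ℕ} (hq : 0 < q) (hm : m < q ^ 3) (k : Fin 3) : gridDigit q m k < q := by
  fin_cases k
  · exact Nat.mod_lt _ hq
  · exact Nat.mod_lt _ hq
  · show m / q / q < q
    rw [Nat.div_lt_iff_lt_mul hq, Nat.div_lt_iff_lt_mul hq]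
    simpa [pow_succ, mul_assoc] using hm

/-- The digits determine the number. [folklore] -/
theorem gridDigit_injective {q : ℕ} : Function.Injective (gridDigit q) := by
  intro m m' h
  have h0 : m % q = m' % q := by simpa [gridDigit] using congrFun h 0
  have h1 : m / q % q = m' / q % q := by simpa [gridDigit] using congrFun h 1
  have h2 : m / q / q = m' / q / q := by simpa [gridDigit] using congrFun h 2
  have hm : m / q = m' / q := by
    rw [← Nat.div_add_mod (m / q) q, ← Nat.div_add_mod (m' / q) q, h1, h2]
  rw [← Nat.div_add_mod m q, ← Nat.div_add_mod m' q, hm, h0]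

/-- The centre `((2d₀+1)/(2q), (2d₁+1)/(2q), (2d₂+1)/(2q))` of the cell of `m` in the grid of
`q³` cells of the unit cube. [folklore] -/
def gridCentre (q m : ℕ) : Space :=
  WithLp.toLp 2 fun k => (2 * (gridDigit q m k : ℝ) + 1) / (2 * q)

/-- Coordinates of the grid centre. [folklore] -/
theorem gridCentre_apply (q m : ℕ) (k : Fin 3) :
    gridCentre q m k = (2 * (gridDigit q m k : ℝ) + 1) / (2 * q) := rfl

/-- The cell of side `1/(4q)` around a grid centre lies in the unit box. [folklore] -/
theorem cubeAt_gridCentre_subset {q m : ℕ} (hq : 0 < q) (hm : m < q ^ 3) :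
    cubeAt (gridCentre q m) (1 / (4 * q)) ⊆ box 1 := by
  have hq0 : (0 : ℝ) < q := by exact_mod_cast hq
  refine cubeAt_subset_box fun k => ?_
  rw [gridCentre_apply]
  have hd : (gridDigit q m k : ℝ) + 1 ≤ q := by exact_mod_cast gridDigit_lt hq hm k
  have hd0 : (0 : ℝ) ≤ gridDigit q m k := Nat.cast_nonneg _
  constructor
  · rw [div_div, div_le_div_iff₀ (by positivity) (by positivity)]
    nlinarith
  · rw [div_div, div_add_div _ _ (by positivity) (by positivity), div_le_one (by positivity)]
    nlinarith

/-- Distinct grid centres are at least `1/q` apart. [folklore] -/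
theorem le_dist_gridCentre {q m m' : ℕ} (hq : 0 < q) (hmm' : m ≠ m') :
    1 / (q : ℝ) ≤ dist (gridCentre q m) (gridCentre q m') := by
  have hq0 : (0 : ℝ) < q := by exact_mod_cast hq
  obtain ⟨k, hk⟩ : ∃ k, gridDigit q m k ≠ gridDigit q m' k := by
    by_contra h
    push Not at h
    exact hmm' (gridDigit_injective (funext h))
  have h1 : (1 : ℝ) ≤ |(gridDigit q m k : ℝ) - gridDigit q m' k| := by
    rcases Nat.lt_or_gt_of_ne hk with h | h
    · have : (gridDigit q m k : ℝ) + 1 ≤ gridDigit q m' k := by exact_mod_cast h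
      rw [abs_sub_comm, abs_of_nonneg (by linarith)]; linarith
    · have : (gridDigit q m' k : ℝ) + 1 ≤ gridDigit q m k := by exact_mod_cast h
      rw [abs_of_nonneg (by linarith)]; linarith
  calc 1 / (q : ℝ) ≤ |(gridDigit q m k : ℝ) - gridDigit q m' k| / q :=
        div_le_div_of_nonneg_right h1 hq0.le
    _ = dist (gridCentre q m k) (gridCentre q m' k) := by
        rw [gridCentre_apply, gridCentre_apply, Real.dist_eq]
        have h2 : (2 * (gridDigit q m k : ℝ) + 1) / (2 * q) - (2 * (gridDigit q m' k : ℝ) + 1) / (2 * q)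
            = ((gridDigit q m k : ℝ) - gridDigit q m' k) / q := by
          field_simp; ring
        rw [h2, abs_div, abs_of_pos hq0]
    _ ≤ dist (gridCentre q m) (gridCentre q m') := PiLp.dist_apply_le _ _ k

/-- **Finite Dirichlet energy of `q³` particles in the unit box for a potential locally integrable
away from the origin**: `E₀^D(q³, 1) < ∞`, by `q³` bumps of side `1/(4q)` at the grid centres
(pairwise `> 1/(2q)` apart). The singularity of `v` at `r = 0` may be non-integrable (e.g.
`r^{-12} 𝟙_{r<R₀}`); hard cores are exactly what this excludes.
[cite: Ruelle1969, §3.3.12 ("ρ_cp = +∞ in the absence of hard cores")] -/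
theorem groundStateEnergy_cube_lt_top_of_locallyIntegrable (hv : Measurable v) (hR : 0 ≤ R₀)
    (hrange : ∀ r, R₀ < r → v r = 0)
    (htail : ∀ b, 0 < b → (∫⁻ x in {x : Space | b < ‖x‖}, v ‖x‖) ≠ ⊤) {q : ℕ} (hq : 0 < q) :
    groundStateEnergy v (q ^ 3) 1 < ⊤ := by
  have hq0 : (0 : ℝ) < q := by exact_mod_cast hq
  have hs0 : (0 : ℝ) < 1 / (4 * q) := by positivity
  have hb0 : (0 : ℝ) < 1 / (2 * q) := by positivity
  obtain ⟨E₁, C, hE₁, hC, hclus⟩ := exists_infEnergy_clusterRegion_le hv hs0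
  have hsep : ∀ m < q ^ 3, ∀ m' < q ^ 3, m ≠ m' →
      1 / (2 * (q : ℝ)) + 2 * (1 / (4 * q)) ≤ dist (gridCentre q m) (gridCentre q m') := by
    intro m _ m' _ hmm'
    have h1 := le_dist_gridCentre hq hmm'
    have h5 : 1 / (2 * (q : ℝ)) + 2 * (1 / (4 * q)) = 1 / q := by field_simp; ring
    linarith
  have hE := groundStateEnergy_le_of_separated_cubes (M := q ^ 3) (L' := 1) hR hrange hs0 hb0
    hclus (gridCentre q) (fun m hm => cubeAt_gridCentre_subset hq hm) hsep
  refine hE.trans_lt (ENNReal.mul_lt_top (ENNReal.natCast_ne_top _).lt_top ?_)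
  refine ENNReal.add_lt_top.2 ⟨hE₁, ?_⟩
  exact ENNReal.mul_lt_top (ENNReal.mul_lt_top hC ENNReal.ofReal_lt_top) (htail _ hb0).lt_top

/-- **For a potential locally integrable away from the origin the upper energy per particle is
finite at every density**: `e⁺(ρ) ≤ E₀^D(q³, 1)/q³ < ∞` with `q³ > ρ(1+R)³`.
[cite: Ruelle1969, §3.3.12 and §3.5.11] -/
theorem limsupEnergyPerParticle_lt_top_of_locallyIntegrable (hv : IsRepulsiveFiniteRange v)
    (htail : ∀ b, 0 < b → (∫⁻ x in {x : Space | b < ‖x‖}, v ‖x‖) ≠ ⊤) {ρ : ℝ} (hρ : 0 < ρ) :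
    limsupEnergyPerParticle v ρ < ⊤ := by
  obtain ⟨R, hR, hv0⟩ := hv.exists_pos_range
  obtain ⟨q, hq⟩ := exists_nat_gt (ρ * (1 + R) ^ 3)
  have hq0 : 0 < q := by
    have : (0 : ℝ) < q := lt_trans (by positivity) hq
    exact_mod_cast this
  have hq1 : (1 : ℝ) ≤ q := by exact_mod_cast hq0
  have hqq : (q : ℝ) ≤ (q : ℝ) ^ 3 := le_self_pow₀ hq1 (by norm_num)
  have hfit : 2 * ρ * (1 + R) ^ 3 < (q ^ 3 + q ^ 3 : ℕ) := by
    push_cast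
    linarith
  refine (limsup_energyPerParticle_le hv.1 hv0 hR hρ one_pos hfit).trans_lt ?_
  have hB := groundStateEnergy_cube_lt_top_of_locallyIntegrable hv.1 hR.le hv0 htail hq0
  exact ENNReal.div_lt_top (ENNReal.add_ne_top.2 ⟨hB.ne, hB.ne⟩)
    (by exact_mod_cast (Nat.add_pos_left (pow_pos hq0 3) _).ne')

/-- **Potentials locally integrable away from the origin have no critical density**:
`(∀ b > 0, ∫_{|x|>b} v(|x|) dx < ∞) ⟹ ρ_c(v) = ∞` — this contains the soft class
`∫_{ℝ³} v < ∞` of `criticalDensity_eq_top_of_lintegral_ne_top` and adds every non-integrable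
repulsive singularity at `r = 0` (inverse powers `r^{-n}`, `n ≥ 3`, cut off at finite range).
[cite: Ruelle1969, §3.3.12 ("ρ_cp = +∞ in the absence of hard cores")] -/
theorem criticalDensity_eq_top_of_locallyIntegrable (hv : IsRepulsiveFiniteRange v)
    (htail : ∀ b, 0 < b → (∫⁻ x in {x : Space | b < ‖x‖}, v ‖x‖) ≠ ⊤) :
    criticalDensity v = ⊤ := by
  refine ENNReal.eq_top_of_forall_nnreal_le fun r => ?_
  have hρ : (0 : ℝ) < r + 1 := by positivity
  calc (r : ℝ≥0∞) ≤ ENNReal.ofReal ((r : ℝ) + 1) := by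
        rw [← ENNReal.ofReal_coe_nnreal]
        exact ENNReal.ofReal_le_ofReal (by linarith)
    _ ≤ criticalDensity v :=
        le_iSup₂ (f := fun ρ (_ : 0 < ρ ∧ limsupEnergyPerParticle v ρ < ⊤) => ENNReal.ofReal ρ)
          ((r : ℝ) + 1) ⟨hρ, limsupEnergyPerParticle_lt_top_of_locallyIntegrable hv htail hρ⟩

end SoftSingular

/-! ### Only the profile on `[0, ∞)` matters -/

section Nonneg

variable {N : ℕ} {v w : ℝ → ℝ≥0∞}

/-- The interaction only sees the profile at non-negative arguments. [folklore] -/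
theorem interaction_congr_nonneg (h : ∀ r, 0 ≤ r → v r = w r) (X : Config N) :
    interaction v X = interaction w X :=
  Finset.sum_congr rfl fun _ _ => Finset.sum_congr rfl fun _ _ => h _ dist_nonneg

/-- So does the Dirichlet ground-state energy. [folklore] -/
theorem groundStateEnergy_congr_nonneg (h : ∀ r, 0 ≤ r → v r = w r) (N : ℕ) (L : ℝ) :
    groundStateEnergy v N L = groundStateEnergy w N L := by
  unfold groundStateEnergy energy
  simp only [interaction_congr_nonneg h]

/-- So does the periodised potential. [folklore] -/
theorem periodizedPotential_congr_nonneg (h : ∀ r, 0 ≤ r → v r = w r) (L : ℝ) (x : Space) :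
    periodizedPotential v L x = periodizedPotential w L x :=
  tsum_congr fun _ => h _ (norm_nonneg _)

/-- So does the periodic ground-state energy. [folklore] -/
theorem periodicGroundStateEnergy_congr_nonneg (h : ∀ r, 0 ≤ r → v r = w r) (N : ℕ) (L : ℝ) :
    periodicGroundStateEnergy v N L = periodicGroundStateEnergy w N L := by
  unfold periodicGroundStateEnergy periodicEnergy periodicInteraction
  simp only [periodizedPotential_congr_nonneg h]

/-- So do the energies per particle. [folklore] -/
theorem energyPerParticleDirichlet_congr_nonneg (h : ∀ r, 0 ≤ r → v r = w r) (ρ : ℝ) :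
    energyPerParticleDirichlet v ρ = energyPerParticleDirichlet w ρ := by
  funext N
  simp only [energyPerParticleDirichlet, groundStateEnergy_congr_nonneg h]

/-- So do the periodic energies per particle. [folklore] -/
theorem energyPerParticlePeriodic_congr_nonneg (h : ∀ r, 0 ≤ r → v r = w r) (ρ : ℝ) :
    energyPerParticlePeriodic v ρ = energyPerParticlePeriodic w ρ := by
  funext N
  simp only [energyPerParticlePeriodic, periodicGroundStateEnergy_congr_nonneg h]

/-- Extension of a profile by `+∞` at negative arguments (physically void): turns "`v = +∞` on
`[0, a)`" into "`v = +∞` on `(-∞, a)`". [folklore] -/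
def extendTop (v : ℝ → ℝ≥0∞) : ℝ → ℝ≥0∞ := fun r => if r < 0 then ⊤ else v r

/-- The extension agrees with `v` on `[0, ∞)`. [folklore] -/
theorem extendTop_of_nonneg {r : ℝ} (hr : 0 ≤ r) : extendTop v r = v r := by
  simp [extendTop, not_lt.2 hr]

/-- The extension is `+∞` below `a` if `v` is `+∞` on `[0, a)`. [folklore] -/
theorem extendTop_eq_top {a r : ℝ} (hcore : ∀ r, 0 ≤ r → r < a → v r = ⊤) (hr : r < a) :
    extendTop v r = ⊤ := by
  by_cases h0 : r < 0
  · simp [extendTop, h0]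
  · rw [extendTop_of_nonneg (not_lt.1 h0)]
    exact hcore r (not_lt.1 h0) hr

/-- The extension stays in the standing class. [folklore] -/
theorem isRepulsiveFiniteRange_extendTop (hv : IsRepulsiveFiniteRange v) :
    IsRepulsiveFiniteRange (extendTop v) := by
  obtain ⟨R, hR, hv0⟩ := hv.exists_pos_range
  refine ⟨Measurable.ite measurableSet_Iio measurable_const hv.1, R, fun r hr => ?_⟩
  rw [extendTop_of_nonneg (by linarith)]
  exact hv0 r hr

end Nonneg

/-! ### The vendored statements for a possibly empty hard core with locally integrable tail -/

section Unified

variable {a : ℝ} {v : ℝ → ℝ≥0∞}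

/-- **Existence of `e₀(ρ)` at every density for the class "hard core `[0,a)` (possibly empty)
plus a tail locally integrable away from the core".** For a repulsive finite-range `v` with
`v = +∞` on `[0, a)` (`a ≥ 0`) and `∫_{|x|>b} v(|x|) dx < ∞` for all `b > a`, the Dirichlet
energies per particle `E₀^D(N, L_N)/N` converge (in `[0, ∞]`) at EVERY `ρ > 0` — the conclusion
of `LSSY2005_e0_dirichlet_exists` with no exceptional density.
[cite: LSSY2005, Ch. 2 eq. (2.2) and the paragraph following it] -/
theorem e0_dirichlet_exists_of_core_locallyIntegrable (hv : IsRepulsiveFiniteRange v) (ha : 0 ≤ a)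
    (hcore : ∀ r, 0 ≤ r → r < a → v r = ⊤)
    (htail : ∀ b, a < b → (∫⁻ x in {x : Space | b < ‖x‖}, v ‖x‖) ≠ ⊤) {ρ : ℝ} (hρ : 0 < ρ) :
    ∃ e : ℝ≥0∞, Tendsto (energyPerParticleDirichlet v ρ) atTop (𝓝 e) := by
  rcases ha.eq_or_lt with h0 | hpos
  · subst h0
    exact ⟨_, tendsto_energyPerParticleDirichlet_of_criticalDensity_eq_top hv
      (criticalDensity_eq_top_of_locallyIntegrable hv htail) hρ⟩
  · have hv' := isRepulsiveFiniteRange_extendTop hv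
    obtain ⟨R, hR, hv0⟩ := hv'.exists_pos_range
    have heq : ∀ r, 0 ≤ r → extendTop v r = v r := fun r hr => extendTop_of_nonneg hr
    have htail' : ∀ b, a < b → (∫⁻ x in {x : Space | b < ‖x‖}, extendTop v ‖x‖) ≠ ⊤ := by
      intro b hb
      simp only [extendTop_of_nonneg (norm_nonneg _)]
      exact htail b hb
    rw [← energyPerParticleDirichlet_congr_nonneg heq]
    exact hardCore_e0_dirichlet_exists' hpos hR.le hv'.1 (fun r hr => extendTop_eq_top hcore hr)
      htail' hv0 hρ

/-- **Boundary-condition independence at every density for the class "hard core `[0,a)`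
(possibly empty) plus a tail locally integrable away from the core".** For a repulsive
finite-range `v` with `v = +∞` on `[0, a)` (`a ≥ 0`) and `∫_{|x|>b} v(|x|) dx < ∞` for all
`b > a`, at EVERY `ρ > 0`: if the Dirichlet energies per particle converge to `e`, so do the
periodic ones — the conclusion of the vendored fact `LSSY2005_e0_periodic_eq_dirichlet`, proved
for every potential of LSSY's standing class that is locally integrable (weight `r²`) off a
pointwise hard core. [cite: LSSY2005, Ch. 2, paragraph after (2.2); Thm. 2.2 ("for all boundary conditions")] -/
theorem e0_periodic_eq_dirichlet_of_core_locallyIntegrable (hv : IsRepulsiveFiniteRange v)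
    (ha : 0 ≤ a) (hcore : ∀ r, 0 ≤ r → r < a → v r = ⊤)
    (htail : ∀ b, a < b → (∫⁻ x in {x : Space | b < ‖x‖}, v ‖x‖) ≠ ⊤) {ρ : ℝ} (hρ : 0 < ρ)
    {e : ℝ≥0∞} (he : Tendsto (energyPerParticleDirichlet v ρ) atTop (𝓝 e)) :
    Tendsto (energyPerParticlePeriodic v ρ) atTop (𝓝 e) := by
  rcases ha.eq_or_lt with h0 | hpos
  · subst h0
    exact tendsto_energyPerParticlePeriodic_of_criticalDensity_eq_top hv
      (criticalDensity_eq_top_of_locallyIntegrable hv htail) hρ he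
  · have hv' := isRepulsiveFiniteRange_extendTop hv
    obtain ⟨R, hR, hv0⟩ := hv'.exists_pos_range
    have heq : ∀ r, 0 ≤ r → extendTop v r = v r := fun r hr => extendTop_of_nonneg hr
    have htail' : ∀ b, a < b → (∫⁻ x in {x : Space | b < ‖x‖}, extendTop v ‖x‖) ≠ ⊤ := by
      intro b hb
      simp only [extendTop_of_nonneg (norm_nonneg _)]
      exact htail b hb
    rw [← energyPerParticleDirichlet_congr_nonneg heq] at he
    rw [← energyPerParticlePeriodic_congr_nonneg heq]
    exact hardCore_e0_periodic_eq_dirichlet' hpos hR.le hv'.1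
      (fun r hr => extendTop_eq_top hcore hr) htail' hv0 hρ he

/-- **The exact residue of the vendored fact after this file.** `LSSY2005_e0_periodic_eq_dirichlet`
(all repulsive finite-range `v`, all `ρ > 0`) is equivalent to its restriction to potentials that
are NOT of the class above — i.e. admit no `a ≥ 0` with `v = +∞` on `[0, a)` and `v(|x|)`
locally integrable on `{|x| > a}` (non-integrable singular shells away from a pointwise hard
core) — and there only at the critical density. [folklore] -/
theorem LSSY2005_e0_periodic_eq_dirichlet_iff_residual :
    LSSY2005_e0_periodic_eq_dirichlet ↔
      ∀ (v : ℝ → ℝ≥0∞), IsRepulsiveFiniteRange v →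
        (¬ ∃ a : ℝ, 0 ≤ a ∧ (∀ r, 0 ≤ r → r < a → v r = ⊤) ∧
            ∀ b, a < b → (∫⁻ x in {x : Space | b < ‖x‖}, v ‖x‖) ≠ ⊤) →
        ∀ ρ : ℝ, 0 < ρ → ENNReal.ofReal ρ = criticalDensity v →
          ∀ e : ℝ≥0∞, Tendsto (energyPerParticleDirichlet v ρ) atTop (𝓝 e) →
            Tendsto (energyPerParticlePeriodic v ρ) atTop (𝓝 e) := by
  constructor
  · intro h v hv _ ρ hρ _ e he
    exact h v hv hv.scatteringLength_ne_top ρ hρ e he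
  · intro h v hv _ ρ hρ e he
    by_cases hcl : ∃ a : ℝ, 0 ≤ a ∧ (∀ r, 0 ≤ r → r < a → v r = ⊤) ∧
        ∀ b, a < b → (∫⁻ x in {x : Space | b < ‖x‖}, v ‖x‖) ≠ ⊤
    · obtain ⟨a, ha, hcore, htail⟩ := hcl
      exact e0_periodic_eq_dirichlet_of_core_locallyIntegrable hv ha hcore htail hρ he
    · by_cases hc : ENNReal.ofReal ρ = criticalDensity v
      · exact h v hv hcl ρ hρ hc e he
      · exact LSSY2005_e0_periodic_eq_dirichlet_offCritical_holds v hv ρ hρ hc e he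

end Unified






end Literature.MathematicalPhysics.QuantumManyBody.BoseGas

end
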